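import Summits.NavierStokesRegularity.NavierStokesRegularity.Theses.AxisymmetricExtremality
import Summits.NavierStokesRegularity.NavierStokesRegularity.Theorems.AxisymmetricExtremalityAxisymmetricKatoGlobalStubSeregin2020TypeIINoSwirlRegularRepr
import Summits.NavierStokesRegularity.NavierStokesRegularity.Theorems.AxisymmetricExtremalityAxisymmetricKatoGlobalStubSeregin2020TypeIINoSwirlSingularStructure
import Summits.NavierStokesRegularity.NavierStokesRegularity.Theorems.AxisymmetricExtremalityAxisymmetricKatoGlobalStubSeregin2020TypeIINoSwirlCoreBoundary
import Summits.NavierStokesRegularity.NavierStokesRegularity.Theorems.AxisymmetricExtremalityAxisymmetricKatoGlobalStubSeregin2020TypeIINoSwirlCoreScalarEq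
import Summits.NavierStokesRegularity.NavierStokesRegularity.Theorems.AxisymmetricExtremalityAxisymmetricKatoGlobalStubSeregin2020TypeIINoSwirlCoreVelocityLocal
import Summits.NavierStokesRegularity.NavierStokesRegularity.Theorems.AxisymmetricExtremalityAxisymmetricKatoGlobalStubSeregin2020TypeIINoSwirlCoreRim
import Summits.NavierStokesRegularity.NavierStokesRegularity.Theorems.AxisymmetricExtremalityAxisymmetricKatoGlobalStubSeregin2020TypeIINoSwirlCoreEnergy
import HarnessLib

/-!
# Seregin 2020, proof of Thm 2.1, the no-swirl endgame: the analytic core — a point of the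
# backward-singular set of a swirl-free axisymmetric local energy ancient solution has no clean
# parabolic past

Helper toward the stub `stub_seregin2020TypeII` of the crux `AxisymmetricKatoGlobal` (= the named
fact `Literature.Analysis.FluidPDE.Seregin2020_axisymmetricSingularPoint_typeII`, G. Seregin,
Anal. Math. Phys. 10 (2020) Paper 46 = arXiv:2006.04140, Thm 2.1), last paragraph of the
printed proof (arXiv p. 8): "any axially symmetric suitable weak solution with no swirl … is
smooth … (it can be done by considering a problem for `η = ω_φ/ϱ` … reduction of it to spatial
dimension 5 …). In particular, the function `u` is a continuous function in `Q̄(R)`". This file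
proves the hypothesis `hcore` of the sibling reduction
`not_isBackwardSingularPoint_of_forall_clean` / `false_of_ae_swirl_eq_zero_of_forall_clean`
(`…NoSwirlReduction`), i.e. the statement (F4) of the lead's frontier map:

* `clean_point_backwardRegular` — for `(w, π)` in Albritton–Barker's class on every `Q(a)` with
  axisymmetric, swirl-free slices, NO point `ẑ = (T, c)` of the backward-singular set
  `Σ = {(t, x) | t ≤ 0, w ∉ L_∞(Q((t,x), r)) ∀ r > 0}` has a clean parabolic past of any radius
  `R > 0` (`Σ ∩ ([T - R², T] × B̄(c, R)) ⊆ {T} × B(c, R)`).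

Proof (assembling the siblings). `c` is on the axis and `Σ` is closed
(`ancientLimit_backwardSingular_structure`), so the clean property holds on an open radius
`R₊ > R` (`exists_radius_gt_clean`); the slab `S = ]T - R², T[ × B(c, R₊)` consists of regular
points (`isRegularPoint_of_backward_bounded`) and carries the smooth axisymmetric swirl-free
representative `V` (`exists_smooth_noSwirl_repr_of_inBall`). The cut-off field
`W = χ V`, `χ = radialCutoff ρ₁ ρ₂ (· - c)`, `R < ρ₁ < ρ₂ < R₊`, satisfies the hypotheses of the
`η`-maximum principle (`cutoffField_vorticity_package`); the rim `{T} × ∂B(c, R)` is backward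
bounded, whence bounds for `curl W`, `D(curl W)₁` near it up to the top time
(`exists_norm_iteratedFDeriv_le_of_backward_bounded`) and the boundary bound for `η`
(`noSwirl_scalar_boundary_bound`); the maximum principle (`noSwirl_abs_scalar_le_of_boundary`,
`norm_curl_le_of_abs_scalar_le`) bounds `curl V` on `[T - R²/2, T) × B̄(c, R)`; the local
Helmholtz bound (`exists_const_norm_le_of_curl_le_local`) with the slice energy of the class
(`exists_ae_lintegral_sq_le_of_inBall`) bounds `V`, first for a.e. time then for every time
(`forall_le_of_ae_restrict_le_of_continuousOn`), near `ẑ` — so `w ∈ L_∞(Q(ẑ, δ))`,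
contradicting `ẑ ∈ Σ`.

## References

* G. Seregin, Anal. Math. Phys. 10 (2020), Paper 46 = arXiv:2006.04140, proof of Thm. 2.1, last
  paragraph (arXiv p. 8). [Seregin2020]
* O. A. Ladyzhenskaya (1968); M. R. Ukhovskii, V. I. Yudovich (1968): regularity of swirl-free
  axisymmetric flows through the maximum principle for `ω_φ/ϱ` (as cited by Seregin via
  [KangK2004]). [KochNadirashviliSereginSverak2009]
-/

-- the problem directory repeats the summit name (D-0017); core's `dupNamespace` linter fires
set_option linter.dupNamespace false

noncomputable section

open MeasureTheory Set Function Filter Topology TopologicalSpace Metric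
open scoped NNReal ENNReal

namespace Summit.NavierStokesRegularity.NavierStokesRegularity.Theorems.AxisymmetricKatoGlobal.EulerScaling

open Literature.Analysis.FluidPDE Literature.Analysis.FluidPDE.SereginZajaczkowski2007

/-- Rotations about the axis preserve the distance to an axis point. [folklore] -/
theorem dist_rotZ_of_axis {c : EuclideanSpace ℝ (Fin 3)} (hc : c 0 = 0 ∧ c 1 = 0) (θ : ℝ)
    (x : EuclideanSpace ℝ (Fin 3)) : dist (rotZ θ x) c = dist x c := by
  have h1 : rotZ θ c = c := by
    ext i
    fin_cases i <;> simp [hc.1, hc.2]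
  rw [dist_eq_norm, dist_eq_norm]
  conv_lhs => rw [← h1]
  rw [← rotZL_apply, ← rotZL_apply, ← map_sub, rotZL_apply, norm_rotZ]

/-- **Bounds for `curl W` and `D(curl W)₁` from bounds for `D_xV`, `D_x²V`**, at a point near
which the globally smooth `W` agrees with `V`. [folklore] -/
theorem curl_bounds_of_iteratedFDeriv_bounds
    {W V : EuclideanSpace ℝ (Fin 3) → EuclideanSpace ℝ (Fin 3)} (hW : ContDiff ℝ (⊤ : ℕ∞) W)
    {y : EuclideanSpace ℝ (Fin 3)} (hWV : W =ᶠ[𝓝 y] V) {K₁ K₂ : ℝ}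
    (h1 : ‖iteratedFDeriv ℝ 1 V y‖ ≤ K₁) (h2 : ‖iteratedFDeriv ℝ 2 V y‖ ≤ K₂) :
    ‖curl W y‖ ≤ ‖curlCLM‖ * K₁ ∧
      ‖fderiv ℝ (fun z => curl W z 1) y‖ ≤
        ‖((EuclideanSpace.proj (1 : Fin 3) : EuclideanSpace ℝ (Fin 3) →L[ℝ] ℝ).comp curlCLM)‖ * K₂ := by
  have e1 : iteratedFDeriv ℝ 1 W y = iteratedFDeriv ℝ 1 V y := (hWV.iteratedFDeriv ℝ 1).eq_of_nhds
  have e2 : iteratedFDeriv ℝ 2 W y = iteratedFDeriv ℝ 2 V y := (hWV.iteratedFDeriv ℝ 2).eq_of_nhds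
  constructor
  · have e : ‖fderiv ℝ W y‖ = ‖iteratedFDeriv ℝ 1 V y‖ := by
      rw [← e1, ← norm_iteratedFDeriv_fderiv, norm_iteratedFDeriv_zero]
    rw [curl_eq_curlCLM]
    calc ‖curlCLM (fderiv ℝ W y)‖ ≤ ‖curlCLM‖ * ‖fderiv ℝ W y‖ :=
          ContinuousLinearMap.le_opNorm _ _
      _ ≤ ‖curlCLM‖ * K₁ := by
          rw [e]; exact mul_le_mul_of_nonneg_left h1 (norm_nonneg curlCLM)
  · set Λ : (EuclideanSpace ℝ (Fin 3) →L[ℝ] EuclideanSpace ℝ (Fin 3)) →L[ℝ] ℝ :=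
      (EuclideanSpace.proj (1 : Fin 3) : EuclideanSpace ℝ (Fin 3) →L[ℝ] ℝ).comp curlCLM with hΛ
    have e : ‖fderiv ℝ (fun z => curl W z 1) y‖ =
        ‖iteratedFDeriv ℝ 1 (fun z => Λ (fderiv ℝ W z)) y‖ := by
      rw [curl_apply_one_eq_clm W, ← norm_iteratedFDeriv_fderiv, norm_iteratedFDeriv_zero]
    rw [e]
    calc ‖iteratedFDeriv ℝ 1 (fun z => Λ (fderiv ℝ W z)) y‖ ≤ ‖Λ‖ * ‖iteratedFDeriv ℝ 2 W y‖ :=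
          norm_iteratedFDeriv_clm_apply_fderiv_le Λ hW 1 y
      _ ≤ ‖Λ‖ * K₂ := by
          rw [e2]; exact mul_le_mul_of_nonneg_left h2 (norm_nonneg Λ)

/-- **Seregin 2020, proof of Thm 2.1, the analytic core of the no-swirl endgame.** Let `(w, π)`
be an Albritton–Barker suitable weak solution in every `Q(a)`, `a > 0`, all of whose slices are
axisymmetric and swirl free, and let
`Σ = {z = (t, x) | t ≤ 0 ∧ ¬ ∃ r > 0, w ∈ L_∞(Q(z, r))}` be its backward-singular set. Then no
`ẑ ∈ Σ` and `R > 0` have the clean-past property "`z ∈ Σ`, `dist x ĉ ≤ R`, `t̂ - R² ≤ t ≤ t̂`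
force `t = t̂` and `dist x ĉ < R`": the local maximum principle for `η = ω_θ/ϱ` of the smooth
swirl-free representative below `t̂`, fed on its parabolic boundary by the regularity of the
rim points up to the top time, bounds the vorticity, hence (local Biot–Savart and the energy
class) the velocity, near `ẑ` — which would make `ẑ` backward regular. This is exactly the
hypothesis `hcore` of `not_isBackwardSingularPoint_of_forall_clean`.
[cite: Seregin2020, proof of Thm 2.1, last paragraph (arXiv p. 8)] -/
theorem clean_point_backwardRegular :
    ∀ (w : ℝ → EuclideanSpace ℝ (Fin 3) → EuclideanSpace ℝ (Fin 3))
      (π : ℝ → EuclideanSpace ℝ (Fin 3) → ℝ), (∀ s, IsAxisymmetric (w s)) →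
      (∀ s, HasNoSwirl (w s)) →
      (∀ a : ℝ, 0 < a → IsSuitableWeakSolutionInBall a 0 w π) →
      ∀ zc ∈ {z : ℝ × EuclideanSpace ℝ (Fin 3) | z.1 ≤ 0 ∧
          ¬ ∃ r > 0, eLpNorm (uncurry w) ∞ (volume.restrict (parabolicCylinder r z)) < ∞},
        ∀ R : ℝ, 0 < R →
          ¬ ∀ z ∈ {z : ℝ × EuclideanSpace ℝ (Fin 3) | z.1 ≤ 0 ∧
              ¬ ∃ r > 0, eLpNorm (uncurry w) ∞ (volume.restrict (parabolicCylinder r z)) < ∞},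
            dist z.2 zc.2 ≤ R → zc.1 - R ^ 2 ≤ z.1 → z.1 ≤ zc.1 →
              z.1 = zc.1 ∧ dist z.2 zc.2 < R := by
  intro w π hax hns hball zc hzc R hR hclean
  obtain ⟨hT0, hzc'⟩ := hzc
  obtain ⟨hclosed, haxis, -⟩ := ancientLimit_backwardSingular_structure w π hax hball
  have hc : zc.2 0 = 0 ∧ zc.2 1 = 0 := (cylRadius_eq_zero_iff zc.2).1 (haxis zc ⟨hT0, hzc'⟩)
  -- ### Step 0: the enlarged clean radius, and backward boundedness off `Σ`
  obtain ⟨Rp, hRRp, -, hcleanp⟩ := exists_radius_gt_clean hclosed hR hclean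
  have hbdd : ∀ z : ℝ × EuclideanSpace ℝ (Fin 3), z.1 ≤ 0 →
      z ∉ {z : ℝ × EuclideanSpace ℝ (Fin 3) | z.1 ≤ 0 ∧
        ¬ ∃ r > 0, eLpNorm (uncurry w) ∞ (volume.restrict (parabolicCylinder r z)) < ∞} →
      ∃ r > 0, eLpNorm (uncurry w) ∞ (volume.restrict (parabolicCylinder r z)) < ∞ := by
    intro z hz0 hz
    by_contra h
    exact hz ⟨hz0, h⟩
  -- points of the open slab are backward bounded
  have hslab : ∀ z : ℝ × EuclideanSpace ℝ (Fin 3), dist z.2 zc.2 < Rp → zc.1 - R ^ 2 < z.1 →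
      z.1 < zc.1 → ∃ r > 0, eLpNorm (uncurry w) ∞ (volume.restrict (parabolicCylinder r z)) < ∞ :=
    fun z hd h1 h2 => hbdd z (h2.le.trans hT0) fun hz => absurd (hcleanp z hz hd h1.le h2.le).1 h2.ne
  -- points of the top rim are backward bounded
  have hrimbd : ∀ x : EuclideanSpace ℝ (Fin 3), dist x zc.2 = R →
      ∃ r > 0, eLpNorm (uncurry w) ∞
        (volume.restrict (parabolicCylinder r ((zc.1, x) : ℝ × EuclideanSpace ℝ (Fin 3)))) < ∞ := by
    intro x hx
    refine hbdd (zc.1, x) hT0 fun hz => ?_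
    have h := (hcleanp (zc.1, x) hz (by rw [hx]; exact hRRp) (by nlinarith) le_rfl).2
    rw [hx] at h
    exact lt_irrefl R h
  -- ### Step 1: the regular slab `S = I × U` and the smooth swirl-free representative
  set I : Set ℝ := Ioo (zc.1 - R ^ 2) zc.1 with hI
  set U : Set (EuclideanSpace ℝ (Fin 3)) := ball zc.2 Rp with hU
  have hIo : IsOpen I := isOpen_Ioo
  have hSo : IsOpen (I ×ˢ U) := hIo.prod isOpen_ball
  set S : Opens (ℝ × EuclideanSpace ℝ (Fin 3)) := ⟨I ×ˢ U, hSo⟩ with hS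
  have hSreg : ∀ z ∈ (S : Set (ℝ × EuclideanSpace ℝ (Fin 3))), IsRegularPoint w z := by
    rintro z ⟨hzI, hzU⟩
    have hlt : z.1 < 0 := lt_of_lt_of_le hzI.2 hT0
    obtain ⟨r, hr, hfin⟩ := hslab z (mem_ball.1 hzU) hzI.1 hzI.2
    exact isRegularPoint_of_backward_bounded hball hlt hr hfin
  have hSrot : ∀ θ : ℝ, ∀ z ∈ (S : Set (ℝ × EuclideanSpace ℝ (Fin 3))),
      ((z.1, rotZ θ z.2) : ℝ × EuclideanSpace ℝ (Fin 3)) ∈ (S : Set (ℝ × EuclideanSpace ℝ (Fin 3))) := by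
    rintro θ z ⟨hzI, hzU⟩
    refine ⟨hzI, ?_⟩
    show rotZ θ z.2 ∈ ball zc.2 Rp
    rw [mem_ball, dist_rotZ_of_axis hc]
    exact mem_ball.1 hzU
  -- a large ball `Q(a₀) ⊇ S`
  have hRp : 0 < Rp := hR.trans hRRp
  set a₀ : ℝ := ‖zc.2‖ + Rp + Real.sqrt (R ^ 2 - zc.1) + 1 with ha₀
  have ha₀pos : 0 < a₀ := by positivity
  have hIsub : I ⊆ Ioo (-a₀ ^ 2) 0 := by
    intro t ht
    have h3 : Real.sqrt (R ^ 2 - zc.1) < a₀ := by rw [ha₀]; linarith [norm_nonneg zc.2]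
    have h4 : Real.sqrt (R ^ 2 - zc.1) ^ 2 < a₀ ^ 2 :=
      pow_lt_pow_left₀ h3 (Real.sqrt_nonneg _) two_ne_zero
    rw [Real.sq_sqrt (by nlinarith)] at h4
    exact ⟨by linarith [ht.1], lt_of_lt_of_le ht.2 hT0⟩
  have hUsub : U ⊆ ball (0 : EuclideanSpace ℝ (Fin 3)) a₀ := by
    intro y hy
    rw [mem_ball, dist_zero_right]
    calc ‖y‖ = dist y 0 := (dist_zero_right _).symm
      _ ≤ dist y zc.2 + dist zc.2 0 := dist_triangle _ _ _
      _ < Rp + ‖zc.2‖ := by rw [dist_zero_right]; linarith [mem_ball.1 hy]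
      _ ≤ a₀ := by rw [ha₀]; linarith [Real.sqrt_nonneg (R ^ 2 - zc.1)]
  have hSQ : S ≤ parabolicCylinderOpens a₀ (0 : ℝ × EuclideanSpace ℝ (Fin 3)) := by
    rintro z ⟨hzI, hzU⟩
    show z ∈ parabolicCylinder a₀ (0 : ℝ × EuclideanSpace ℝ (Fin 3))
    rw [mem_parabolicCylinder]
    simp only [Prod.fst_zero, Prod.snd_zero, zero_sub]
    exact ⟨hIsub hzI, mem_ball.1 (hUsub hzU)⟩
  obtain ⟨V, hV, hae, hV0⟩ :=
    exists_smooth_noSwirl_repr_of_inBall w π a₀ (hball a₀ ha₀pos) hax hns S hSQ hSreg hSrot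
  have hVc : ContinuousOn (uncurry V) (I ×ˢ U) := hV.continuousOn_velocity
  -- ### Step 2: the cut-off field and the package
  set ρ₁ : ℝ := (2 * R + Rp) / 3 with hρ₁
  set ρ₂ : ℝ := (R + 2 * Rp) / 3 with hρ₂
  have h₁ : 0 < ρ₁ := by positivity
  have hRρ₁ : R < ρ₁ := by rw [hρ₁]; linarith
  have h₁₂ : ρ₁ < ρ₂ := by rw [hρ₁, hρ₂]; linarith
  have h₂₃ : ρ₂ < Rp := by rw [hρ₂]; linarith
  set W : ℝ → EuclideanSpace ℝ (Fin 3) → EuclideanSpace ℝ (Fin 3) :=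
    fun τ y => radialCutoff ρ₁ ρ₂ (y - zc.2) • V τ y with hW
  have hsubS : I ×ˢ ball zc.2 Rp ⊆ (S : Set (ℝ × EuclideanSpace ℝ (Fin 3))) := fun z hz => hz
  obtain ⟨hsmooth, hunif, haxW, hswW, hvort, hvortc⟩ := cutoffField_vorticity_package S V π I
    zc.2 ρ₁ ρ₂ Rp W hV hIo ordConnected_Ioo hc h₁ h₁₂ h₂₃ hsubS
    (fun t ht y hy => hV0 (t, y) ⟨ht, hy⟩) (fun τ => rfl)
  have hWV : ∀ τ : ℝ, ∀ y ∈ ball zc.2 ρ₁, W τ =ᶠ[𝓝 y] V τ := fun τ y hy =>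
    radialCutoffField_eventuallyEq (V := V) h₁ h₁₂ τ hy
  -- ### Step 3: the rim bounds
  set t₀ : ℝ := zc.1 - R ^ 2 / 2 with ht₀
  have ht₀I : t₀ ∈ I := ⟨by rw [ht₀]; nlinarith, by rw [ht₀]; nlinarith⟩
  have ht₀T : t₀ < zc.1 := by rw [ht₀]; nlinarith
  have hIcoI : Ico t₀ zc.1 ⊆ I := fun t ht => ⟨lt_of_lt_of_le ht₀I.1 ht.1, ht.2⟩
  have hrim : ∀ x ∈ sphere zc.2 R, ∃ r > 0, ∃ K : ℝ, ∀ t ∈ Ico t₀ zc.1, zc.1 - r < t →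
      ∀ y ∈ ball x r, ‖curl (W t) y‖ ≤ K ∧ ‖fderiv ℝ (fun z => curl (W t) z 1) y‖ ≤ K := by
    intro x hx
    have hxR : dist x zc.2 = R := mem_sphere.1 hx
    obtain ⟨r, hr, hfin⟩ := hrimbd x hxR
    -- shrink the cylinder into the slab and into `{χ = 1}`
    set r' : ℝ := min r (min R (ρ₁ - R)) with hr'
    have hr'pos : 0 < r' := lt_min hr (lt_min hR (by linarith))
    have hr'r : r' ≤ r := min_le_left _ _
    have hr'R : r' ≤ R := (min_le_right _ _).trans (min_le_left _ _)
    have hr'ρ : r' ≤ ρ₁ - R := (min_le_right _ _).trans (min_le_right _ _)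
    have hQS : parabolicCylinder r' ((zc.1, x) : ℝ × EuclideanSpace ℝ (Fin 3)) ⊆ I ×ˢ U := by
      intro q hq
      rw [mem_parabolicCylinder] at hq
      refine ⟨⟨?_, hq.1.2⟩, ?_⟩
      · have : r' ^ 2 ≤ R ^ 2 := pow_le_pow_left₀ hr'pos.le hr'R 2
        linarith [hq.1.1]
      · rw [hU, mem_ball]
        calc dist q.2 zc.2 ≤ dist q.2 x + dist x zc.2 := dist_triangle _ _ _
          _ < r' + R := by rw [hxR]; linarith [hq.2]
          _ ≤ ρ₁ := by linarith
          _ < Rp := by linarith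
    have hfin' : eLpNorm (uncurry w) ∞ (volume.restrict
        (parabolicCylinder r' ((zc.1, x) : ℝ × EuclideanSpace ℝ (Fin 3)))) < ∞ :=
      (eLpNorm_mono_measure _ (Measure.restrict_mono
        (parabolicCylinder_mono hr'pos.le hr'r _) le_rfl)).trans_lt hfin
    have hb := fun n => exists_norm_iteratedFDeriv_le_of_backward_bounded w π hball (zc.1, x) r'
      hT0 hr'pos hfin' V (hVc.mono hQS) (ae_restrict_of_ae_restrict_of_subset hQS hae) n
    obtain ⟨r₁, hr₁, K₁, hK₁⟩ := hb 1
    obtain ⟨r₂, hr₂, K₂, hK₂⟩ := hb 2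
    set r₃ : ℝ := min r' (min r₁ r₂) with hr₃
    have hr₃pos : 0 < r₃ := lt_min hr'pos (lt_min hr₁ hr₂)
    set rr : ℝ := min r₃ (r₃ ^ 2) with hrr
    have hrrpos : 0 < rr := lt_min hr₃pos (by positivity)
    refine ⟨rr, hrrpos, max (‖curlCLM‖ * K₁)
      (‖((EuclideanSpace.proj (1 : Fin 3) : EuclideanSpace ℝ (Fin 3) →L[ℝ] ℝ).comp curlCLM)‖ * K₂),
      fun t ht htr y hy => ?_⟩
    have hyr₃ : dist y x < r₃ := (mem_ball.1 hy).trans_le (min_le_left _ _)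
    have htr₃ : zc.1 - r₃ ^ 2 < t := by linarith [min_le_right r₃ (r₃ ^ 2)]
    have hmem : ∀ ρ : ℝ, r₃ ≤ ρ → ((t, y) : ℝ × EuclideanSpace ℝ (Fin 3)) ∈
        parabolicCylinder ρ ((zc.1, x) : ℝ × EuclideanSpace ℝ (Fin 3)) := fun ρ hρ => by
      rw [mem_parabolicCylinder]
      have : r₃ ^ 2 ≤ ρ ^ 2 := pow_le_pow_left₀ hr₃pos.le hρ 2
      exact ⟨⟨by linarith, ht.2⟩, hyr₃.trans_le hρ⟩
    have hyρ₁ : y ∈ ball zc.2 ρ₁ := by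
      rw [mem_ball]
      calc dist y zc.2 ≤ dist y x + dist x zc.2 := dist_triangle _ _ _
        _ < r₃ + R := by rw [hxR]; linarith
        _ ≤ ρ₁ := by linarith [min_le_left r' (min r₁ r₂)]
    have h1 := hK₁ (t, y) (hmem r₁ ((min_le_right _ _).trans (min_le_left _ _)))
    have h2 := hK₂ (t, y) (hmem r₂ ((min_le_right _ _).trans (min_le_right _ _)))
    obtain ⟨hb1, hb2⟩ := curl_bounds_of_iteratedFDeriv_bounds (hsmooth t (hIcoI ht)) (hWV t y hyρ₁) h1 h2
    exact ⟨hb1.trans (le_max_left _ _), hb2.trans (le_max_right _ _)⟩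
  -- ### Step 4: the boundary bound and the maximum principle
  obtain ⟨M, hbot, hlat⟩ := noSwirl_scalar_boundary_bound W zc.2 R t₀ zc.1 ht₀T
    (fun τ hτ => hsmooth τ (hIcoI hτ))
    (fun k τ hτ ε hε => by
      obtain ⟨δ, hδ, h⟩ := hunif k τ (hIcoI hτ) ε hε
      exact ⟨δ, hδ, fun τ' hτ' hlt y => h τ' (hIcoI hτ') hlt y⟩)
    (fun τ hτ => haxW τ (hIcoI hτ)) (fun τ hτ => hswW τ (hIcoI hτ)) hrim
  have hf : ∀ t ∈ Ico t₀ zc.1, ∀ x ∈ closedBall zc.2 R,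
      |hadamardQuotFst (fun z => curl (W t) z 1) x| ≤ M := by
    intro t ht x hx
    exact noSwirl_abs_scalar_le_of_boundary hIo ordConnected_Ioo hsmooth hunif haxW hswW hvort
      hvortc (f := fun τ => hadamardQuotFst fun z => curl (W τ) z 1) (fun _ => rfl) hc hRρ₁.le
      ht₀I (hIcoI ht) hbot (fun s hs y hy => hlat s ⟨hs.1, lt_of_le_of_lt hs.2 ht.2⟩ y hy)
      t ⟨ht.1, le_rfl⟩ x hx
  have hM0 : 0 ≤ M := (abs_nonneg _).trans (hbot zc.2 (mem_closedBall_self hR.le))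
  have hcurlV : ∀ t ∈ Ico t₀ zc.1, ∀ x ∈ closedBall zc.2 R, ‖curl (V t) x‖ ≤ M * R := by
    intro t ht x hx
    have hxρ : x ∈ ball zc.2 ρ₁ := mem_ball.2 (lt_of_le_of_lt (mem_closedBall.1 hx) hRρ₁)
    rw [← (radialCutoffField_local (V := V) h₁ h₁₂ t hxρ).2.2.1]
    exact norm_curl_le_of_abs_scalar_le (hsmooth t (hIcoI ht)) (haxW t (hIcoI ht))
      (hswW t (hIcoI ht)) hc hM0 (hf t ht) hx
  -- ### Step 5: the velocity bound near `ẑ`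
  obtain ⟨Cv, hCv0, hCv⟩ := exists_const_norm_le_of_curl_le_local
  obtain ⟨Ce, hCe⟩ := exists_ae_lintegral_sq_le_of_inBall w V π a₀ I U (hball a₀ ha₀pos) hIsub
    hUsub hae
  obtain ⟨hdiv, -, -⟩ := vorticity_hasDerivAt_of_isSmoothAxisymmetricSolutionOn hV hIo isOpen_ball
    hsubS
  set s : ℝ := R / 4 with hs
  have hspos : 0 < s := by positivity
  set B : ℝ := 2 * (M * R) * s + Cv * (s ^ 3)⁻¹ *
    ((volume (closedBall (0 : EuclideanSpace ℝ (Fin 3)) (2 * s))).toReal + Ce) with hB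
  have hIooI : Ioo t₀ zc.1 ⊆ I := fun t ht => ⟨lt_trans ht₀I.1 ht.1, ht.2⟩
  have hVbd_ae : ∀ x' ∈ ball zc.2 s, ∀ᵐ t ∂(volume.restrict (Ioo t₀ zc.1)), ‖V t x'‖ ≤ B := by
    intro x' hx'
    have h3R : ball x' (3 * s) ⊆ closedBall zc.2 R := by
      intro y hy
      rw [mem_closedBall]
      have := dist_triangle y x' zc.2
      linarith [mem_ball.1 hy, mem_ball.1 hx']
    have h3U : ball x' (3 * s) ⊆ U := h3R.trans (closedBall_subset_ball (by linarith))
    have h2U : closedBall x' (2 * s) ⊆ U :=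
      ((closedBall_subset_ball (by linarith)).trans h3U)
    filter_upwards [ae_restrict_of_ae_restrict_of_subset hIooI hCe,
      ae_restrict_mem measurableSet_Ioo] with t htC ht
    have htI : t ∈ I := hIooI ht
    -- the local `L¹` bound
    have hVt : ContinuousOn (V t) U :=
      hVc.comp (Continuous.prodMk_right t).continuousOn fun y hy => ⟨htI, hy⟩
    have hL1 : ∫ y in closedBall x' (2 * s), ‖V t y‖ ≤
        (volume (closedBall (0 : EuclideanSpace ℝ (Fin 3)) (2 * s))).toReal + Ce := by
      rw [← Measure.addHaar_closedBall_center volume x' (2 * s)]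
      exact setIntegral_norm_le_of_lintegral_sq_le (isCompact_closedBall _ _) (hVt.mono h2U)
        ((lintegral_mono_set h2U).trans htC)
    refine (hCv (V t) x' s (M * R) hspos (fun y hy => (hV.contDiffAt (t, y) ⟨htI, h3U hy⟩).of_le
      (by norm_cast)) (fun y hy => hdiv (t, y) ⟨htI, h3U hy⟩)
      (fun y hy => hcurlV t ⟨ht.1.le, ht.2⟩ y (h3R hy))).trans ?_
    rw [hB]
    have h0 : 0 ≤ Cv * (s ^ 3)⁻¹ := by positivity
    nlinarith [mul_le_mul_of_nonneg_left hL1 h0]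
  -- every time, by continuity
  have hVbd : ∀ x' ∈ ball zc.2 s, ∀ t ∈ Ioo t₀ zc.1, ‖V t x'‖ ≤ B := by
    intro x' hx'
    refine forall_le_of_ae_restrict_le_of_continuousOn isOpen_Ioo ?_ (hVbd_ae x' hx')
    have hx'U : x' ∈ U := by
      rw [hU, mem_ball]; linarith [mem_ball.1 hx']
    exact (hVc.comp (Continuous.prodMk_left x').continuousOn fun t ht => ⟨hIooI ht, hx'U⟩).norm
  -- ### Step 6: `w ∈ L_∞(Q(ẑ, δ))`, a contradiction
  set δ : ℝ := min s (R / 2) with hδ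
  have hδpos : 0 < δ := lt_min hspos (by positivity)
  have hQsub : parabolicCylinder δ zc ⊆ Ioo t₀ zc.1 ×ˢ ball zc.2 s := by
    intro q hq
    rw [mem_parabolicCylinder] at hq
    have hδ2 : δ ^ 2 ≤ (R / 2) ^ 2 := pow_le_pow_left₀ hδpos.le (min_le_right _ _) 2
    refine ⟨⟨?_, hq.1.2⟩, mem_ball.2 (hq.2.trans_le (min_le_left _ _))⟩
    rw [ht₀]; nlinarith [hq.1.1]
  have hQS : parabolicCylinder δ zc ⊆ I ×ˢ U := hQsub.trans (prod_mono hIooI (ball_subset_ball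
    (by linarith)))
  refine hzc' ⟨δ, hδpos, eLpNorm_top_lt_top_of_repr_bound (isOpen_parabolicCylinder δ zc).measurableSet
    (ae_restrict_of_ae_restrict_of_subset hQS hae) (B := B) fun q hq => ?_⟩
  obtain ⟨hq1, hq2⟩ := hQsub hq
  exact hVbd q.2 hq2 q.1 hq1

end Summit.NavierStokesRegularity.NavierStokesRegularity.Theorems.AxisymmetricKatoGlobal.EulerScaling

end
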